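/-
Copyright (c) 2026 the pub-hodgecm-mathlib formalisation cell (harness21).  Prover seat hodgecm-mathlib-K2E1-p16 (g4), Track B ∕ K2-LIT, h413 = `stmt-HodgeConjecture-24833`,
R90-TF section S8 «ContSpec-n½», socket (E) :276 (N₃) row, S8 dealer R90-CS-plan (g3) S8-R241 (3) ∕ S8-R245 J-S8-E16 ∕ S8-R248 (3) lineage: FILE C of the χ_τ-IDEMPOTENT EDITION — the
(N₃) letters of record ★ `resG_isotypic_le_orthogonal_residueSpan_of_lineModel` and ★ `hNblk_of_record` (K2E1-p14 (g4)) with `(hχmul, hχone)` REPLACED by CONVOLUTION IDEMPOTENCE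
`hχconv`, so the `hNblk Kf b` bytes of ★ `res_exhaustion_le_closure_of_record` are reachable at `χ := χ_τ♮ = dim τ • conj χ_τ` for `K_∞`-types of ANY dimension, exactly as the
one-dimensional road reaches them.
-/
import Summits.HodgeConjecture.HodgeConjecture.Theorems.R90S8ResGIsotypicTauLinesU3           -- ★ FILE B (this seat): `resG_isotypic_le_orthogonal_lines_of_conv`; brings ★ FILE A, ★ (N_blk,₃), ★ G-DEFS
import Summits.HodgeConjecture.HodgeConjecture.Theorems.R90S8ResGIsotypicLeLinesOfRecordU3      -- ★ p863747 (K2E1-p14 (g4)): §1 `oneSlot_orthogonal_le_ker`, `oneSlot_mem_of_snd_eq_zero` (one-slot model); brings ★ `hNblk_of_lineModel`, `orthogonal_inf_orthogonal_mono`, `mem_resGAtom_iff`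
import HarnessLib

/-!
# R90-TF · S8 «ContSpec-n½» — `R90S8ResGIsotypicTauResidueSpanU3`: THE χ_τ-IDEMPOTENT EDITION, FILE C — THE (N₃) LETTERS OF RECORD AT ANY RESIDUE SPACE AND THE `hNblk Kf b` BYTES,
# CONVOLUTION IDEMPOTENCE IN PLACE OF MULTIPLICATIVITY

Cell `hodgecm-mathlib`, crux H413 (`stmt-HodgeConjecture-24833`, lane `--supports … --as helper`), route of record `HCCMUnconditional`; R90-TF section S8, socket (E) `sock_S8_res_exhaustion_le_closure`
(B ED. 7 :276) via ★ `res_exhaustion_le_closure_of_record`, (N₃) row.  THEOREMS ONLY (no `def`, no `instance`, no `notation`, no named-fact hypothesis, no `sorry`; default heartbeats);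
count-neutral; CLOSES NO SOCKET; pays no letter by itself.

WHAT THIS FILE DOES.  ★ FILE A (`R90S8ResGIsotypicTauIdempotentModelU3`) showed `(hχmul, hχone)` enter the D5′ chain only through `P_χ² = P_χ`, which the weaker CONVOLUTION IDEMPOTENCE
`hχconv : χ = χ ⋆ χ` gives — true for multiplicative kernels AND for the χ_τ-idempotent `χ_τ♮` of an irreducible unitary `K_∞`-type `τ` of any dimension (★ `tauIdem_mulConv`); ★ FILE B
(`R90S8ResGIsotypicTauLinesU3`) re-keyed D5′'s three consumers up to ★ `resG_isotypic_le_orthogonal_lines_of_conv`.  This file re-keys the last two rungs of the one-dimensional road,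
STATEMENTS = ★ `R90S8ResGIsotypicLeLinesOfRecordU3` §2–§3 BYTE FOR BYTE except `(hχmul : …) (hχone : …)` ↦ `(hχconv : ∀ x, χ x = mulConv μK χ χ x)` and the frame gains
`[IsTopologicalGroup K] [SecondCountableTopology K]` (`[MeasurableMul K]` dropped as automatic), BODIES = ★'s with `resG_isotypic_le_orthogonal_lines` ↦ `…_of_conv`:
* §1 **`resG_isotypic_le_orthogonal_residueSpan_of_lineModel_of_conv`** — (N₃) at ANY level datum `(K′, ω)` and ANY residue space `A`: an irreducible of `L²_res(U(J₃), 𝔓)` has no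
  `(K′, ω)`-isotypic mass in `Sc ⊓ Aᗮ`, modulo D5′'s letters in the `U_Λ`-currency and the completeness letter (C) `hC` (one-slot model `(0, U_Λ ∘ P_{Sc})`, ★ §1 read-backs).
* §2 **`hNblk_of_record_of_conv`** — THE `hNblk Kf b` BYTES of ★ `res_exhaustion_le_closure_of_record` at the index of record `(ι_f Kf, 1)` and `A := span eTop ⊔ span eMid`, over ★
  `hNblk_of_lineModel`.
CONSUMER SHAPE (the (N₃) per-τ road for `dim τ > 1`): `χ` from ★ `exists_characterEstate_of_tau` (formula, `hχconv`, `hχinv`, and the level kernel `e` with `he0 he1 heK hestar` in one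
`obtain`), `P := R_K(χ_τ♮) ∘L R_f(e)` (`hPdef := rfl`), `hScP` for the τ-cut block := ★ F0P2-p10 (g4) `hScP_tauCut_of_record` over ★ FILE A's «`R_K(χ_τ♮) = id` on `N_τ`», then §2 here and
★ F0P2-p10 (g4) `hNblk_of_tauCuts` glue the τ-cuts; the remaining visible bill per τ-cut block is D5′'s (L1) `T hT𝓐 hTP hTB` (F0P2-p10's (4)), (L2) `U_Λ s hs hUΛ`, (L3) `hline`, (C) `hC` —
the E1 Plancherel estate proper, unchanged.
HONEST LABEL: HC_CM is proved only modulo the 7 printed citations (2 remaining named inputs: hLiu418 = `stmt-HodgeConjecture-24832`, h413 = `stmt-HodgeConjecture-24833`) until rung 0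
closes; REL ≠ ★ ≠ BUILT; this file asserts no named fact, is conditional by construction on its visible binders, and closes no socket; count-neutral.

## References
* [MoeglinWaldspurger1995] C. Mœglin, J.-L. Waldspurger, *Spectral Decomposition and Eisenstein Series* (1995), IV.3.12 (b), V.3.13, VI.2.
* [Rogawski1990] J. D. Rogawski, *Automorphic Representations of Unitary Groups in Three Variables* (1990), §13.9 p. 229.
* [ReedSimonI1980] M. Reed, B. Simon, *Methods of Modern Mathematical Physics I* (1980), Thm. II.3, Thm. VII.2.
* [BrockerTomDieck1985] T. Bröcker, T. tom Dieck, *Representations of Compact Lie Groups*, GTM 98 (1985), II (4.16), III (5.10).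
-/

set_option autoImplicit false
set_option linter.dupNamespace false  -- the mandated namespace `…HodgeConjecture.HodgeConjecture.R90.S8` (LEAD #1 L1) repeats the summit's segment

noncomputable section

open MeasureTheory Filter Topology CompactlySupported NumberField ContRepresentation Set
open scoped InnerProductSpace ENNReal ComplexConjugate
open Literature.NumberTheory.Automorphic Literature.NumberTheory.Automorphic.UnitaryGroup Literature.NumberTheory.GaloisRepresentations AdelicGroupData
open Literature.NumberTheory.Automorphic.Arthur2013.Leaves.TECR
open Summit.HodgeConjecture.HodgeConjecture.Cruxes.H413.K2E1CuspidalSpectrumUnitary (residualSubspace)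
open Summit.HodgeConjecture.HodgeConjecture.Cruxes.H413.K2E1HeckeAlgebraLettersCM

namespace Summit.HodgeConjecture.HodgeConjecture.R90.S8

/-! ## §1–§2 At Mok's `U(J₃) = quasiSplit L⁺ L c 3`: the (N₃) letter from ★ (N_blk,₃)-conv at the one-slot model — CONVOLUTION EDITION -/

section Record

variable (L : Type) [Field L] [NumberField L] [IsCMField L]
  (μ : Measure (quasiSplit (↥(maximalRealSubfield L)) L (IsCMField.complexConj L) 3).automorphicQuotient)
  [(quasiSplit (↥(maximalRealSubfield L)) L (IsCMField.complexConj L) 3).IsAutomorphicMeasure μ]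
  {K : Type*} [Group K] [TopologicalSpace K] [IsTopologicalGroup K] [MeasurableSpace K] [BorelSpace K] [SecondCountableTopology K]
  [MeasurableSpace (UnitaryGroup.arch (↥(maximalRealSubfield L)) L (IsCMField.complexConj L) 3 ((StdForm.antidiagonal 3).over L))] [BorelSpace (UnitaryGroup.arch (↥(maximalRealSubfield L)) L (IsCMField.complexConj L) 3 ((StdForm.antidiagonal 3).over L))]
  [MeasurableSpace (finAdelic (↥(maximalRealSubfield L)) L (IsCMField.complexConj L) 3 ((StdForm.antidiagonal 3).over L))] [BorelSpace (finAdelic (↥(maximalRealSubfield L)) L (IsCMField.complexConj L) 3 ((StdForm.antidiagonal 3).over L))]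
  (νinf : Measure (UnitaryGroup.arch (↥(maximalRealSubfield L)) L (IsCMField.complexConj L) 3 ((StdForm.antidiagonal 3).over L))) [IsFiniteMeasureOnCompacts νinf] [νinf.IsMulLeftInvariant] [νinf.IsInvInvariant] [νinf.IsOpenPosMeasure]
  (νf : Measure (finAdelic (↥(maximalRealSubfield L)) L (IsCMField.complexConj L) 3 ((StdForm.antidiagonal 3).over L))) [IsFiniteMeasureOnCompacts νf] [νf.IsMulLeftInvariant] [νf.IsInvInvariant] [νf.IsOpenPosMeasure]
  (κ : K →* UnitaryGroup.arch (↥(maximalRealSubfield L)) L (IsCMField.complexConj L) 3 ((StdForm.antidiagonal 3).over L)) (hκ : Continuous κ)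
  (μK : Measure K) [IsFiniteMeasureOnCompacts μK] [IsProbabilityMeasure μK] [μK.IsMulLeftInvariant] [MeasurableInv K] [μK.IsInvInvariant]
  (χ : C_c(K, ℂ)) (e : C_c(finAdelic (↥(maximalRealSubfield L)) L (IsCMField.complexConj L) 3 ((StdForm.antidiagonal 3).over L), ℂ))
  {Ω : Type*} {mΩ : MeasurableSpace Ω} (m : Measure Ω) {E : Type*} [NormedAddCommGroup E] [NormedSpace ℂ E] {J : Type*} [Countable J]
variable [ENNReal.HolderTriple ∞ 2 2]

/-- **(N₃) AT ANY LEVEL DATUM AND ANY RESIDUE SPACE, CONVOLUTION EDITION** of ★ `resG_isotypic_le_orthogonal_residueSpan_of_lineModel` (K2E1-p14 (g4)): «an irreducible of `L²_res(U(J₃), 𝔓)`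
has no `(K′, ω)`-isotypic mass in `Sc ⊓ Aᗮ`», modulo D5′'s letters with a CONVOLUTION-IDEMPOTENT K-type kernel `χ` (`hχconv hχinv` — e.g. `χ_τ♮` of a `K_∞`-type of any dimension, ★
`exists_characterEstate_of_tau`), `K′f e he0 he1 heK hestar`, `P hPdef`, (L1) `T hT𝓐 hTP hTB`, (L2) in the `U_Λ`-currency `UΛ s hs hUΛ`, (L3) `hline`, `hScP`, and (C) `hC : U_Λ v = 0 → v ∈ A`
on `Sc`.  PROOF = ★'s: ★ FILE B `resG_isotypic_le_orthogonal_lines_of_conv` at the one-slot model `U′ := (0, U_Λ ∘ P_{Sc})`, then `(resGLine U′)ᗮ ≤ (Sc ⊓ Aᗮ)ᗮ`.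
[cite: MoeglinWaldspurger1995, IV.3.12, V.3.13, VI.2] [cite: Rogawski1990, §13.9 p. 229] [cite: ReedSimonI1980, Thm. II.3] -/
theorem resG_isotypic_le_orthogonal_residueSpan_of_lineModel_of_conv
    (𝔓 : (quasiSplit (↥(maximalRealSubfield L)) L (IsCMField.complexConj L) 3).ParabolicUnipotentData)
    (K' : Subgroup (quasiSplit (↥(maximalRealSubfield L)) L (IsCMField.complexConj L) 3).Adelic) (ω : ↥K' →* ℂ)
    (χ₁ : HeckeCharacter L) (χ₂ : ↥(TorusDict.torus (IsCMField.complexConj L)) →ₜ* ℂˣ)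
    (hχconv : ∀ x, χ x = mulConv μK (⇑χ) (⇑χ) x) (hχinv : ∀ k, conj (χ k⁻¹) = χ k)
    (K'f : Subgroup (finAdelic (↥(maximalRealSubfield L)) L (IsCMField.complexConj L) 3 ((StdForm.antidiagonal 3).over L))) (he0 : ∀ x, x ∉ K'f → e x = 0) (he1 : ∫ x, e x ∂νf = 1)
    (heK : ∀ k ∈ K'f, ∀ x, e (k * x) = e x) (hestar : ∀ x, mulStar (⇑e) x = e x)
    (P : (quasiSplit (↥(maximalRealSubfield L)) L (IsCMField.complexConj L) 3).L2 μ →L[ℂ] (quasiSplit (↥(maximalRealSubfield L)) L (IsCMField.complexConj L) 3).L2 μ)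
    (hPdef : P = ((((quasiSplit (↥(maximalRealSubfield L)) L (IsCMField.complexConj L) 3).rightRegular μ).restrict ((archToAdelic (↥(maximalRealSubfield L)) L (IsCMField.complexConj L) 3 ((StdForm.antidiagonal 3).over L)).comp κ)).integratedOperator (((quasiSplit (↥(maximalRealSubfield L)) L (IsCMField.complexConj L) 3).isUnitary_rightRegular μ).restrict _)
          (((quasiSplit (↥(maximalRealSubfield L)) L (IsCMField.complexConj L) 3).isStronglyContinuous_rightRegular_holds μ).restrict _ ((continuous_archToAdelic (↥(maximalRealSubfield L)) L (IsCMField.complexConj L) 3 ((StdForm.antidiagonal 3).over L)).comp hκ)) μK χ ∘L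
        (((quasiSplit (↥(maximalRealSubfield L)) L (IsCMField.complexConj L) 3).rightRegular μ).restrict (finAdelicToAdelic (↥(maximalRealSubfield L)) L (IsCMField.complexConj L) 3 ((StdForm.antidiagonal 3).over L))).integratedOperator (((quasiSplit (↥(maximalRealSubfield L)) L (IsCMField.complexConj L) 3).isUnitary_rightRegular μ).restrict _) (((quasiSplit (↥(maximalRealSubfield L)) L (IsCMField.complexConj L) 3).isStronglyContinuous_rightRegular_holds μ).restrict _ (continuous_finAdelicToAdelic (↥(maximalRealSubfield L)) L (IsCMField.complexConj L) 3 ((StdForm.antidiagonal 3).over L))) νf e))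
    (T : J → (quasiSplit (↥(maximalRealSubfield L)) L (IsCMField.complexConj L) 3).L2 μ →L[ℂ] (quasiSplit (↥(maximalRealSubfield L)) L (IsCMField.complexConj L) 3).L2 μ)
    (hT𝓐 : ∀ j, T j ∈ {A' : (quasiSplit (↥(maximalRealSubfield L)) L (IsCMField.complexConj L) 3).L2 μ →L[ℂ] (quasiSplit (↥(maximalRealSubfield L)) L (IsCMField.complexConj L) 3).L2 μ | ∃ (a : C_c(UnitaryGroup.arch (↥(maximalRealSubfield L)) L (IsCMField.complexConj L) 3 ((StdForm.antidiagonal 3).over L), ℂ)) (b : C_c(finAdelic (↥(maximalRealSubfield L)) L (IsCMField.complexConj L) 3 ((StdForm.antidiagonal 3).over L), ℂ)),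
      A' = (((quasiSplit (↥(maximalRealSubfield L)) L (IsCMField.complexConj L) 3).rightRegular μ).restrict (archToAdelic (↥(maximalRealSubfield L)) L (IsCMField.complexConj L) 3 ((StdForm.antidiagonal 3).over L))).integratedOperator (((quasiSplit (↥(maximalRealSubfield L)) L (IsCMField.complexConj L) 3).isUnitary_rightRegular μ).restrict _) (((quasiSplit (↥(maximalRealSubfield L)) L (IsCMField.complexConj L) 3).isStronglyContinuous_rightRegular_holds μ).restrict _ (continuous_archToAdelic (↥(maximalRealSubfield L)) L (IsCMField.complexConj L) 3 ((StdForm.antidiagonal 3).over L))) νinf a ∘L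
          (((quasiSplit (↥(maximalRealSubfield L)) L (IsCMField.complexConj L) 3).rightRegular μ).restrict (finAdelicToAdelic (↥(maximalRealSubfield L)) L (IsCMField.complexConj L) 3 ((StdForm.antidiagonal 3).over L))).integratedOperator (((quasiSplit (↥(maximalRealSubfield L)) L (IsCMField.complexConj L) 3).isUnitary_rightRegular μ).restrict _) (((quasiSplit (↥(maximalRealSubfield L)) L (IsCMField.complexConj L) 3).isStronglyContinuous_rightRegular_holds μ).restrict _ (continuous_finAdelicToAdelic (↥(maximalRealSubfield L)) L (IsCMField.complexConj L) 3 ((StdForm.antidiagonal 3).over L))) νf b})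
    (hTP : ∀ j, Commute P (T j))
    (hTB : ∀ j, ∀ A' ∈ {A' : (quasiSplit (↥(maximalRealSubfield L)) L (IsCMField.complexConj L) 3).L2 μ →L[ℂ] (quasiSplit (↥(maximalRealSubfield L)) L (IsCMField.complexConj L) 3).L2 μ | ∃ (a : C_c(UnitaryGroup.arch (↥(maximalRealSubfield L)) L (IsCMField.complexConj L) 3 ((StdForm.antidiagonal 3).over L), ℂ)) (b : C_c(finAdelic (↥(maximalRealSubfield L)) L (IsCMField.complexConj L) 3 ((StdForm.antidiagonal 3).over L), ℂ)),
      A' = (((quasiSplit (↥(maximalRealSubfield L)) L (IsCMField.complexConj L) 3).rightRegular μ).restrict (archToAdelic (↥(maximalRealSubfield L)) L (IsCMField.complexConj L) 3 ((StdForm.antidiagonal 3).over L))).integratedOperator (((quasiSplit (↥(maximalRealSubfield L)) L (IsCMField.complexConj L) 3).isUnitary_rightRegular μ).restrict _) (((quasiSplit (↥(maximalRealSubfield L)) L (IsCMField.complexConj L) 3).isStronglyContinuous_rightRegular_holds μ).restrict _ (continuous_archToAdelic (↥(maximalRealSubfield L)) L (IsCMField.complexConj L) 3 ((StdForm.antidiagonal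 3).over L))) νinf a ∘L
          (((quasiSplit (↥(maximalRealSubfield L)) L (IsCMField.complexConj L) 3).rightRegular μ).restrict (finAdelicToAdelic (↥(maximalRealSubfield L)) L (IsCMField.complexConj L) 3 ((StdForm.antidiagonal 3).over L))).integratedOperator (((quasiSplit (↥(maximalRealSubfield L)) L (IsCMField.complexConj L) 3).isUnitary_rightRegular μ).restrict _) (((quasiSplit (↥(maximalRealSubfield L)) L (IsCMField.complexConj L) 3).isStronglyContinuous_rightRegular_holds μ).restrict _ (continuous_finAdelicToAdelic (↥(maximalRealSubfield L)) L (IsCMField.complexConj L) 3 ((StdForm.antidiagonal 3).over L))) νf b},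
      ∀ x ∈ LinearMap.eqLocus (P : (quasiSplit (↥(maximalRealSubfield L)) L (IsCMField.complexConj L) 3).L2 μ →ₗ[ℂ] (quasiSplit (↥(maximalRealSubfield L)) L (IsCMField.complexConj L) 3).L2 μ) LinearMap.id, P (A' (T j x)) = T j (P (A' x)))
    (UΛ : ↥(resGBlock L μ K' ω χ₁ χ₂) →ₗ[ℂ] Lp E 2 m) (s : J → Ω → ℂ) (hs : ∀ j, MemLp (s j) ∞ m)
    (hUΛ : haveI : CompleteSpace ↥(resGBlock L μ K' ω χ₁ χ₂) := (isClosed_resGBlock L μ _ _ χ₁ χ₂).completeSpace_coe;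
      ∀ j, ∀ v ∈ LinearMap.eqLocus (P : (quasiSplit (↥(maximalRealSubfield L)) L (IsCMField.complexConj L) 3).L2 μ →ₗ[ℂ] (quasiSplit (↥(maximalRealSubfield L)) L (IsCMField.complexConj L) 3).L2 μ) LinearMap.id,
        UΛ ((resGBlock L μ K' ω χ₁ χ₂).orthogonalProjectionOnto (T j v)) = ((hs j).toLp (s j) • UΛ ((resGBlock L μ K' ω χ₁ χ₂).orthogonalProjectionOnto v) : Lp E 2 m))
    (hline : ∀ c : J → ℂ, m {x | ∀ j, s j x = c j} = 0)
    (hScP : resGBlock L μ K' ω χ₁ χ₂ ≤ LinearMap.eqLocus (P : (quasiSplit (↥(maximalRealSubfield L)) L (IsCMField.complexConj L) 3).L2 μ →ₗ[ℂ] (quasiSplit (↥(maximalRealSubfield L)) L (IsCMField.complexConj L) 3).L2 μ) LinearMap.id)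
    (A : Submodule ℂ ((quasiSplit (↥(maximalRealSubfield L)) L (IsCMField.complexConj L) 3).L2 μ)) (hC : ∀ v : ↥(resGBlock L μ K' ω χ₁ χ₂), UΛ v = 0 → (v : (quasiSplit (↥(maximalRealSubfield L)) L (IsCMField.complexConj L) 3).L2 μ) ∈ A) :
    ∀ W' : ClosedSubrep ((quasiSplit (↥(maximalRealSubfield L)) L (IsCMField.complexConj L) 3).rightRegular μ), W'.toContRep.IsTopIrreducible →
      W' ≤ residualSubspace (quasiSplit (↥(maximalRealSubfield L)) L (IsCMField.complexConj L) 3) μ 𝔓 →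
        W'.toSubmodule ⊓ (⨅ k : ↥K', Module.End.eigenspace ((((quasiSplit (↥(maximalRealSubfield L)) L (IsCMField.complexConj L) 3).rightRegular μ) (K'.subtype k) : (quasiSplit (↥(maximalRealSubfield L)) L (IsCMField.complexConj L) 3).L2 μ →L[ℂ] (quasiSplit (↥(maximalRealSubfield L)) L (IsCMField.complexConj L) 3).L2 μ) :
          (quasiSplit (↥(maximalRealSubfield L)) L (IsCMField.complexConj L) 3).L2 μ →ₗ[ℂ] (quasiSplit (↥(maximalRealSubfield L)) L (IsCMField.complexConj L) 3).L2 μ) (ω k)) ≤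
          (resGBlock L μ K' ω χ₁ χ₂ ⊓ Aᗮ)ᗮ := by
  haveI : CompleteSpace ↥(resGBlock L μ K' ω χ₁ χ₂) := (isClosed_resGBlock L μ K' ω χ₁ χ₂).completeSpace_coe
  intro W' hW' hres
  exact (resG_isotypic_le_orthogonal_lines_of_conv L μ νinf νf κ hκ μK χ e m 𝔓 K' ω χ₁ χ₂ hχconv hχinv K'f he0 he1 heK hestar P hPdef T hT𝓐 hTP hTB
      ((0 : (quasiSplit (↥(maximalRealSubfield L)) L (IsCMField.complexConj L) 3).L2 μ →ₗ[ℂ] ℂ × ℂ).prod (UΛ ∘ₗ (resGBlock L μ K' ω χ₁ χ₂).orthogonalProjectionOnto.toLinearMap)) s hs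
      (fun j v hv => hUΛ j v hv) hline hScP (oneSlot_orthogonal_le_ker _ UΛ) W' hW' hres).trans
    (orthogonal_inf_orthogonal_mono _ _ _ fun v hv =>
      oneSlot_mem_of_snd_eq_zero _ UΛ A hC ((mem_resGAtom_iff L μ _ K' ω χ₁ χ₂ v).1 hv).1 ((mem_resGAtom_iff L μ _ K' ω χ₁ χ₂ v).1 hv).2)

/-- **THE (N₃) LETTER OF RECORD `hNblk`, CONVOLUTION EDITION** of ★ `hNblk_of_record` (K2E1-p14 (g4)): at the index of record `(K′, ω) := (ι_f Kf, 1)` and the residue space `A := span (range eTop)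
⊔ span (range eMid)`, §1's letters (with the CONVOLUTION-IDEMPOTENT kernel `χ`) give `W ⊓ Fix(ι_f Kf) ≤ (Sc ⊓ (span eTop ⊔ span eMid)ᗮ)ᗮ` for every irreducible residual `W` — the `hNblk Kf b`
bytes of ★ `res_exhaustion_le_closure_of_record`, one `exact` of ★ `hNblk_of_lineModel` over ★ FILE B `resG_isotypic_le_orthogonal_lines_of_conv`.  At `χ := χ_τ♮` (★ `exists_characterEstate_of_tau`)
this is the (N₃) road for `K_∞`-types of ANY dimension. [cite: MoeglinWaldspurger1995, IV.3.12, V.3.13, VI.2] [cite: Rogawski1990, §13.9 p. 229] -/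
theorem hNblk_of_record_of_conv
    (𝔓 : (quasiSplit (↥(maximalRealSubfield L)) L (IsCMField.complexConj L) 3).ParabolicUnipotentData)
    (Kf : Subgroup ↥(finAdelic (↥(maximalRealSubfield L)) L (IsCMField.complexConj L) 3 ((StdForm.antidiagonal 3).over L)))
    (χ₁ : HeckeCharacter L) (χ₂ : ↥(TorusDict.torus (IsCMField.complexConj L)) →ₜ* ℂˣ)
    (hχconv : ∀ x, χ x = mulConv μK (⇑χ) (⇑χ) x) (hχinv : ∀ k, conj (χ k⁻¹) = χ k)
    (K'f : Subgroup (finAdelic (↥(maximalRealSubfield L)) L (IsCMField.complexConj L) 3 ((StdForm.antidiagonal 3).over L))) (he0 : ∀ x, x ∉ K'f → e x = 0) (he1 : ∫ x, e x ∂νf = 1)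
    (heK : ∀ k ∈ K'f, ∀ x, e (k * x) = e x) (hestar : ∀ x, mulStar (⇑e) x = e x)
    (P : (quasiSplit (↥(maximalRealSubfield L)) L (IsCMField.complexConj L) 3).L2 μ →L[ℂ] (quasiSplit (↥(maximalRealSubfield L)) L (IsCMField.complexConj L) 3).L2 μ)
    (hPdef : P = ((((quasiSplit (↥(maximalRealSubfield L)) L (IsCMField.complexConj L) 3).rightRegular μ).restrict ((archToAdelic (↥(maximalRealSubfield L)) L (IsCMField.complexConj L) 3 ((StdForm.antidiagonal 3).over L)).comp κ)).integratedOperator (((quasiSplit (↥(maximalRealSubfield L)) L (IsCMField.complexConj L) 3).isUnitary_rightRegular μ).restrict _)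
          (((quasiSplit (↥(maximalRealSubfield L)) L (IsCMField.complexConj L) 3).isStronglyContinuous_rightRegular_holds μ).restrict _ ((continuous_archToAdelic (↥(maximalRealSubfield L)) L (IsCMField.complexConj L) 3 ((StdForm.antidiagonal 3).over L)).comp hκ)) μK χ ∘L
        (((quasiSplit (↥(maximalRealSubfield L)) L (IsCMField.complexConj L) 3).rightRegular μ).restrict (finAdelicToAdelic (↥(maximalRealSubfield L)) L (IsCMField.complexConj L) 3 ((StdForm.antidiagonal 3).over L))).integratedOperator (((quasiSplit (↥(maximalRealSubfield L)) L (IsCMField.complexConj L) 3).isUnitary_rightRegular μ).restrict _) (((quasiSplit (↥(maximalRealSubfield L)) L (IsCMField.complexConj L) 3).isStronglyContinuous_rightRegular_holds μ).restrict _ (continuous_finAdelicToAdelic (↥(maximalRealSubfield L)) L (IsCMField.complexConj L) 3 ((StdForm.antidiagonal 3).over L))) νf e))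
    (T : J → (quasiSplit (↥(maximalRealSubfield L)) L (IsCMField.complexConj L) 3).L2 μ →L[ℂ] (quasiSplit (↥(maximalRealSubfield L)) L (IsCMField.complexConj L) 3).L2 μ)
    (hT𝓐 : ∀ j, T j ∈ {A' : (quasiSplit (↥(maximalRealSubfield L)) L (IsCMField.complexConj L) 3).L2 μ →L[ℂ] (quasiSplit (↥(maximalRealSubfield L)) L (IsCMField.complexConj L) 3).L2 μ | ∃ (a : C_c(UnitaryGroup.arch (↥(maximalRealSubfield L)) L (IsCMField.complexConj L) 3 ((StdForm.antidiagonal 3).over L), ℂ)) (b : C_c(finAdelic (↥(maximalRealSubfield L)) L (IsCMField.complexConj L) 3 ((StdForm.antidiagonal 3).over L), ℂ)),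
      A' = (((quasiSplit (↥(maximalRealSubfield L)) L (IsCMField.complexConj L) 3).rightRegular μ).restrict (archToAdelic (↥(maximalRealSubfield L)) L (IsCMField.complexConj L) 3 ((StdForm.antidiagonal 3).over L))).integratedOperator (((quasiSplit (↥(maximalRealSubfield L)) L (IsCMField.complexConj L) 3).isUnitary_rightRegular μ).restrict _) (((quasiSplit (↥(maximalRealSubfield L)) L (IsCMField.complexConj L) 3).isStronglyContinuous_rightRegular_holds μ).restrict _ (continuous_archToAdelic (↥(maximalRealSubfield L)) L (IsCMField.complexConj L) 3 ((StdForm.antidiagonal 3).over L))) νinf a ∘L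
          (((quasiSplit (↥(maximalRealSubfield L)) L (IsCMField.complexConj L) 3).rightRegular μ).restrict (finAdelicToAdelic (↥(maximalRealSubfield L)) L (IsCMField.complexConj L) 3 ((StdForm.antidiagonal 3).over L))).integratedOperator (((quasiSplit (↥(maximalRealSubfield L)) L (IsCMField.complexConj L) 3).isUnitary_rightRegular μ).restrict _) (((quasiSplit (↥(maximalRealSubfield L)) L (IsCMField.complexConj L) 3).isStronglyContinuous_rightRegular_holds μ).restrict _ (continuous_finAdelicToAdelic (↥(maximalRealSubfield L)) L (IsCMField.complexConj L) 3 ((StdForm.antidiagonal 3).over L))) νf b})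
    (hTP : ∀ j, Commute P (T j))
    (hTB : ∀ j, ∀ A' ∈ {A' : (quasiSplit (↥(maximalRealSubfield L)) L (IsCMField.complexConj L) 3).L2 μ →L[ℂ] (quasiSplit (↥(maximalRealSubfield L)) L (IsCMField.complexConj L) 3).L2 μ | ∃ (a : C_c(UnitaryGroup.arch (↥(maximalRealSubfield L)) L (IsCMField.complexConj L) 3 ((StdForm.antidiagonal 3).over L), ℂ)) (b : C_c(finAdelic (↥(maximalRealSubfield L)) L (IsCMField.complexConj L) 3 ((StdForm.antidiagonal 3).over L), ℂ)),
      A' = (((quasiSplit (↥(maximalRealSubfield L)) L (IsCMField.complexConj L) 3).rightRegular μ).restrict (archToAdelic (↥(maximalRealSubfield L)) L (IsCMField.complexConj L) 3 ((StdForm.antidiagonal 3).over L))).integratedOperator (((quasiSplit (↥(maximalRealSubfield L)) L (IsCMField.complexConj L) 3).isUnitary_rightRegular μ).restrict _) (((quasiSplit (↥(maximalRealSubfield L)) L (IsCMField.complexConj L) 3).isStronglyContinuous_rightRegular_holds μ).restrict _ (continuous_archToAdelic (↥(maximalRealSubfield L)) L (IsCMField.complexConj L) 3 ((StdForm.antidiagonal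 3).over L))) νinf a ∘L
          (((quasiSplit (↥(maximalRealSubfield L)) L (IsCMField.complexConj L) 3).rightRegular μ).restrict (finAdelicToAdelic (↥(maximalRealSubfield L)) L (IsCMField.complexConj L) 3 ((StdForm.antidiagonal 3).over L))).integratedOperator (((quasiSplit (↥(maximalRealSubfield L)) L (IsCMField.complexConj L) 3).isUnitary_rightRegular μ).restrict _) (((quasiSplit (↥(maximalRealSubfield L)) L (IsCMField.complexConj L) 3).isStronglyContinuous_rightRegular_holds μ).restrict _ (continuous_finAdelicToAdelic (↥(maximalRealSubfield L)) L (IsCMField.complexConj L) 3 ((StdForm.antidiagonal 3).over L))) νf b},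
      ∀ x ∈ LinearMap.eqLocus (P : (quasiSplit (↥(maximalRealSubfield L)) L (IsCMField.complexConj L) 3).L2 μ →ₗ[ℂ] (quasiSplit (↥(maximalRealSubfield L)) L (IsCMField.complexConj L) 3).L2 μ) LinearMap.id, P (A' (T j x)) = T j (P (A' x)))
    (UΛ : ↥(resGBlock L μ (Kf.map (finAdelicToAdelic (↥(maximalRealSubfield L)) L (IsCMField.complexConj L) 3 ((StdForm.antidiagonal 3).over L))) 1 χ₁ χ₂) →ₗ[ℂ] Lp E 2 m) (s : J → Ω → ℂ) (hs : ∀ j, MemLp (s j) ∞ m)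
    (hUΛ : haveI : CompleteSpace ↥(resGBlock L μ (Kf.map (finAdelicToAdelic (↥(maximalRealSubfield L)) L (IsCMField.complexConj L) 3 ((StdForm.antidiagonal 3).over L))) 1 χ₁ χ₂) := (isClosed_resGBlock L μ _ _ χ₁ χ₂).completeSpace_coe;
      ∀ j, ∀ v ∈ LinearMap.eqLocus (P : (quasiSplit (↥(maximalRealSubfield L)) L (IsCMField.complexConj L) 3).L2 μ →ₗ[ℂ] (quasiSplit (↥(maximalRealSubfield L)) L (IsCMField.complexConj L) 3).L2 μ) LinearMap.id,
        UΛ ((resGBlock L μ (Kf.map (finAdelicToAdelic (↥(maximalRealSubfield L)) L (IsCMField.complexConj L) 3 ((StdForm.antidiagonal 3).over L))) 1 χ₁ χ₂).orthogonalProjectionOnto (T j v)) = ((hs j).toLp (s j) • UΛ ((resGBlock L μ (Kf.map (finAdelicToAdelic (↥(maximalRealSubfield L)) L (IsCMField.complexConj L) 3 ((StdForm.antidiagonal 3).over L))) 1 χ₁ χ₂).orthogonalProjectionOnto v) : Lp E 2 m))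
    (hline : ∀ c : J → ℂ, m {x | ∀ j, s j x = c j} = 0)
    (hScP : resGBlock L μ (Kf.map (finAdelicToAdelic (↥(maximalRealSubfield L)) L (IsCMField.complexConj L) 3 ((StdForm.antidiagonal 3).over L))) 1 χ₁ χ₂ ≤ LinearMap.eqLocus (P : (quasiSplit (↥(maximalRealSubfield L)) L (IsCMField.complexConj L) 3).L2 μ →ₗ[ℂ] (quasiSplit (↥(maximalRealSubfield L)) L (IsCMField.complexConj L) 3).L2 μ) LinearMap.id)
    {ιt ιm : Type*} (eTop : ιt → (quasiSplit (↥(maximalRealSubfield L)) L (IsCMField.complexConj L) 3).L2 μ) (eMid : ιm → (quasiSplit (↥(maximalRealSubfield L)) L (IsCMField.complexConj L) 3).L2 μ)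
    (hC : ∀ v : ↥(resGBlock L μ (Kf.map (finAdelicToAdelic (↥(maximalRealSubfield L)) L (IsCMField.complexConj L) 3 ((StdForm.antidiagonal 3).over L))) 1 χ₁ χ₂), UΛ v = 0 → (v : (quasiSplit (↥(maximalRealSubfield L)) L (IsCMField.complexConj L) 3).L2 μ) ∈ Submodule.span ℂ (Set.range eTop) ⊔ Submodule.span ℂ (Set.range eMid)) :
    ∀ W : ClosedSubrep ((quasiSplit (↥(maximalRealSubfield L)) L (IsCMField.complexConj L) 3).rightRegular μ), W.toContRep.IsTopIrreducible → W ≤ residualSubspace (quasiSplit (↥(maximalRealSubfield L)) L (IsCMField.complexConj L) 3) μ 𝔓 →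
      W.toSubmodule ⊓ (⨅ u : ↥(Kf), Module.End.eigenspace ((((quasiSplit (↥(maximalRealSubfield L)) L (IsCMField.complexConj L) 3).rightRegular μ) (finAdelicToAdelic (↥(maximalRealSubfield L)) L (IsCMField.complexConj L) 3 ((StdForm.antidiagonal 3).over L) (u : ↥(finAdelic (↥(maximalRealSubfield L)) L (IsCMField.complexConj L) 3 ((StdForm.antidiagonal 3).over L)))) :
        (quasiSplit (↥(maximalRealSubfield L)) L (IsCMField.complexConj L) 3).L2 μ →L[ℂ] (quasiSplit (↥(maximalRealSubfield L)) L (IsCMField.complexConj L) 3).L2 μ) : (quasiSplit (↥(maximalRealSubfield L)) L (IsCMField.complexConj L) 3).L2 μ →ₗ[ℂ] (quasiSplit (↥(maximalRealSubfield L)) L (IsCMField.complexConj L) 3).L2 μ) 1) ≤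
        (resGBlock L μ (Kf.map (finAdelicToAdelic (↥(maximalRealSubfield L)) L (IsCMField.complexConj L) 3 ((StdForm.antidiagonal 3).over L))) 1 χ₁ χ₂ ⊓ (Submodule.span ℂ (Set.range eTop) ⊔ Submodule.span ℂ (Set.range eMid))ᗮ)ᗮ := by
  haveI : CompleteSpace ↥(resGBlock L μ (Kf.map (finAdelicToAdelic (↥(maximalRealSubfield L)) L (IsCMField.complexConj L) 3 ((StdForm.antidiagonal 3).over L))) 1 χ₁ χ₂) := (isClosed_resGBlock L μ _ 1 χ₁ χ₂).completeSpace_coe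
  exact hNblk_of_lineModel L μ 𝔓 Kf χ₁ χ₂ ((0 : (quasiSplit (↥(maximalRealSubfield L)) L (IsCMField.complexConj L) 3).L2 μ →ₗ[ℂ] ℂ × ℂ).prod (UΛ ∘ₗ (resGBlock L μ (Kf.map (finAdelicToAdelic (↥(maximalRealSubfield L)) L (IsCMField.complexConj L) 3 ((StdForm.antidiagonal 3).over L))) 1 χ₁ χ₂).orthogonalProjectionOnto.toLinearMap))
    (Submodule.span ℂ (Set.range eTop) ⊔ Submodule.span ℂ (Set.range eMid))
    (fun v hv => oneSlot_mem_of_snd_eq_zero _ UΛ _ hC ((mem_resGAtom_iff L μ _ _ 1 χ₁ χ₂ v).1 hv).1 ((mem_resGAtom_iff L μ _ _ 1 χ₁ χ₂ v).1 hv).2)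
    (resG_isotypic_le_orthogonal_lines_of_conv L μ νinf νf κ hκ μK χ e m 𝔓 (Kf.map (finAdelicToAdelic (↥(maximalRealSubfield L)) L (IsCMField.complexConj L) 3 ((StdForm.antidiagonal 3).over L))) 1 χ₁ χ₂ hχconv hχinv K'f he0 he1 heK hestar P hPdef T hT𝓐 hTP hTB
      ((0 : (quasiSplit (↥(maximalRealSubfield L)) L (IsCMField.complexConj L) 3).L2 μ →ₗ[ℂ] ℂ × ℂ).prod (UΛ ∘ₗ (resGBlock L μ (Kf.map (finAdelicToAdelic (↥(maximalRealSubfield L)) L (IsCMField.complexConj L) 3 ((StdForm.antidiagonal 3).over L))) 1 χ₁ χ₂).orthogonalProjectionOnto.toLinearMap)) s hs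
      (fun j v hv => hUΛ j v hv) hline hScP (oneSlot_orthogonal_le_ker _ UΛ))

end Record

end Summit.HodgeConjecture.HodgeConjecture.R90.S8

end
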